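import Mathlib.Analysis.Convex.Deriv
import Mathlib.Analysis.SpecialFunctions.Log.Deriv
import Mathlib.Analysis.SpecialFunctions.ExpDeriv
import Mathlib.Analysis.SpecialFunctions.Pow.Real
import Mathlib.Tactic.Linarith
import Mathlib.Tactic.Positivity
import Mathlib.Tactic.Ring
import Mathlib.Tactic.FieldSimp
import Mathlib.Tactic.LinearCombination
import HarnessLib

/-!
# `NoHeavyLowerTail` (stmt-CriticalPhenomena-4575) — the PROFILE row APL-P is preserved by a pendant apex (the calculus step of THEOREM B_P)

Support file (prover prim-ineq-gen-8 gen 37; `--supports stmt-CriticalPhenomena-4575`; memos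
run/shared/lean/prim/prim-ineq-gen-8/FINDING-gen31-APL-PROFILE.md §5(b) and this generation's FINDING-gen37).  Pure real
analysis/algebra: no definitions, no named facts, no sorries.

SETTING (as in `…APLProfile.lean`).  Cells `u0 = P(a|b|c)`, `uab = P(ab|c)`, `uac = P(ac|b)`, `ubc = P(a|bc)`, `u3 = P(abc)` of an
instance `(a; b, c)` (nonnegative, sum `1`); isolation probabilities `isoA = u0 + ubc`, `isoB = u0 + uac`, `isoC = u0 + uab`;
`e = uab + uac`, `D = u0 + e`, `T = e + u3`.  The PROFILE row (gen 31, conjectured for every finite weighted graph, tight along the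
extremal Poisson hub-tree hierarchy at every scale) is
  **APL-P:  u0³ ≤ isoA · (isoB · isoC)^{3/2}**,  in squared polynomial form  `u0⁶ ≤ isoA² (isoB·isoC)³`;
it implies APL(2/3) (`APL.apl23_of_profile_cells`).  A PENDANT apex `a — g` of weight `z ∈ [0,1]` maps the cells `u` of `(g; b, c)` to
`(u0 + (1−z)e, z·uab, z·uac, ubc + (1−z)u3, z·u3)` (`…APLPendantCells.lean`), i.e. `(u0, isoA, isoB, isoC) ↦
((1−z)D + z·u0, (1−z) + z·isoA, (1−z)D + z·isoB, (1−z)D + z·isoC)`.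
* `profile_pendant` — **APL-P is preserved by the pendant map** (the step of THEOREM B_P left unformalised by gen 31).
  Proof: `G(z) := (D − ze)³ / ((D − z·uab)(D − z·uac))^{3/2}` is CONVEX on `[0,1]`:  with `m = D − ze`, `a' = m·uab/(D − z·uab)`,
  `b' = m·uac/(D − z·uac)` (so `0 ≤ a' ≤ uab`, `0 ≤ b' ≤ uac`) one has the exact identity
  `G'' = ((D − z·uab)(D − z·uac))^{−3/2} · m · [3(e − a' − b')(2e − a' − b') + (3/4)(a' − b')²] ≥ 0`;
  hence `G(z) ≤ (1−z)G(0) + zG(1) = (1−z) + z·u0³/(isoB·isoC)^{3/2} ≤ 1 − zT` (the hypothesis), which is APL-P of the image.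
  (The inequality is third-order tangent at `z = 0` in the symmetric case, which is why no termwise AM–GM proof exists.)
* `profile_convex`, `profile_chord`, `profile_deriv2_nonneg` and the `HasDerivAt` lemmas are the calculus bookkeeping
  (`G = m³ · exp(−(3/2)(log(D − z·uab) + log(D − z·uac)))`, second-derivative test `convexOn_of_hasDerivWithinAt2_nonneg`).
[this work]
-/

namespace Summit.CriticalPhenomena.PercolationContinuityZ3.Theorems

namespace APL

/-- `d/dz [−(3/2)(log(d − zp) + log(d − zq))] = (3/2)(p/(d − zp) + q/(d − zq))`. [folklore] -/
theorem profile_hasDerivAt_H (d p q z : ℝ) (hA : d - z * p ≠ 0) (hB : d - z * q ≠ 0) :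
    HasDerivAt (fun z => -(3 / 2 : ℝ) * (Real.log (d - z * p) + Real.log (d - z * q)))
      ((3 / 2 : ℝ) * (p * (d - z * p)⁻¹ + q * (d - z * q)⁻¹)) z := by
  have hA' : HasDerivAt (fun z => d - z * p) (-(1 * p)) z := ((hasDerivAt_id' z).mul_const p).const_sub d
  have hB' : HasDerivAt (fun z => d - z * q) (-(1 * q)) z := ((hasDerivAt_id' z).mul_const q).const_sub d
  refine (((hA'.log hA).add (hB'.log hB)).const_mul (-(3 / 2 : ℝ))).congr_deriv ?_
  simp only [div_eq_mul_inv]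
  ring

/-- `d/dz [(3/2)(p/(d − zp) + q/(d − zq))] = (3/2)(p²/(d − zp)² + q²/(d − zq)²)`. [folklore] -/
theorem profile_hasDerivAt_H' (d p q z : ℝ) (hA : d - z * p ≠ 0) (hB : d - z * q ≠ 0) :
    HasDerivAt (fun z => (3 / 2 : ℝ) * (p * (d - z * p)⁻¹ + q * (d - z * q)⁻¹))
      ((3 / 2 : ℝ) * (p ^ 2 * ((d - z * p)⁻¹) ^ 2 + q ^ 2 * ((d - z * q)⁻¹) ^ 2)) z := by
  have hA' : HasDerivAt (fun z => d - z * p) (-(1 * p)) z := ((hasDerivAt_id' z).mul_const p).const_sub d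
  have hB' : HasDerivAt (fun z => d - z * q) (-(1 * q)) z := ((hasDerivAt_id' z).mul_const q).const_sub d
  refine ((((hA'.fun_inv hA).const_mul p).add ((hB'.fun_inv hB).const_mul q)).const_mul
    (3 / 2 : ℝ)).congr_deriv ?_
  simp only [div_eq_mul_inv, inv_pow]
  ring

/-- First derivative of `G(z) = (d − z(p+q))³ · exp(−(3/2)(log(d − zp) + log(d − zq)))`. [folklore] -/
theorem profile_hasDerivAt_G (d p q z : ℝ) (hA : d - z * p ≠ 0) (hB : d - z * q ≠ 0) :
    HasDerivAt (fun z => (d - z * (p + q)) ^ 3 * Real.exp (-(3 / 2 : ℝ) * (Real.log (d - z * p) + Real.log (d - z * q))))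
      (Real.exp (-(3 / 2 : ℝ) * (Real.log (d - z * p) + Real.log (d - z * q))) *
        (-3 * (p + q) * (d - z * (p + q)) ^ 2
          + (d - z * (p + q)) ^ 3 * ((3 / 2 : ℝ) * (p * (d - z * p)⁻¹ + q * (d - z * q)⁻¹)))) z := by
  have hM : HasDerivAt (fun z => d - z * (p + q)) (-(1 * (p + q))) z :=
    ((hasDerivAt_id' z).mul_const (p + q)).const_sub d
  have hE := (profile_hasDerivAt_H d p q z hA hB).exp
  refine ((hM.fun_pow 3).mul hE).congr_deriv ?_
  norm_num
  ring

/-- Second derivative of `G`: the derivative of `G'`. [folklore] -/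
theorem profile_hasDerivAt_G' (d p q z : ℝ) (hA : d - z * p ≠ 0) (hB : d - z * q ≠ 0) :
    HasDerivAt (fun z => Real.exp (-(3 / 2 : ℝ) * (Real.log (d - z * p) + Real.log (d - z * q))) *
        (-3 * (p + q) * (d - z * (p + q)) ^ 2
          + (d - z * (p + q)) ^ 3 * ((3 / 2 : ℝ) * (p * (d - z * p)⁻¹ + q * (d - z * q)⁻¹))))
      (Real.exp (-(3 / 2 : ℝ) * (Real.log (d - z * p) + Real.log (d - z * q)))
          * ((3 / 2 : ℝ) * (p * (d - z * p)⁻¹ + q * (d - z * q)⁻¹))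
          * (-3 * (p + q) * (d - z * (p + q)) ^ 2
              + (d - z * (p + q)) ^ 3 * ((3 / 2 : ℝ) * (p * (d - z * p)⁻¹ + q * (d - z * q)⁻¹)))
        + Real.exp (-(3 / 2 : ℝ) * (Real.log (d - z * p) + Real.log (d - z * q)))
          * (6 * (p + q) ^ 2 * (d - z * (p + q))
              - 3 * (p + q) * (d - z * (p + q)) ^ 2 * ((3 / 2 : ℝ) * (p * (d - z * p)⁻¹ + q * (d - z * q)⁻¹))
              + (d - z * (p + q)) ^ 3
                  * ((3 / 2 : ℝ) * (p ^ 2 * ((d - z * p)⁻¹) ^ 2 + q ^ 2 * ((d - z * q)⁻¹) ^ 2)))) z := by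
  have hM : HasDerivAt (fun z => d - z * (p + q)) (-(1 * (p + q))) z :=
    ((hasDerivAt_id' z).mul_const (p + q)).const_sub d
  have hH := profile_hasDerivAt_H d p q z hA hB
  have hE := hH.exp
  have hH' := profile_hasDerivAt_H' d p q z hA hB
  have hP : HasDerivAt (fun z => -3 * (p + q) * (d - z * (p + q)) ^ 2
        + (d - z * (p + q)) ^ 3 * ((3 / 2 : ℝ) * (p * (d - z * p)⁻¹ + q * (d - z * q)⁻¹)))
      (6 * (p + q) ^ 2 * (d - z * (p + q))
        - 3 * (p + q) * (d - z * (p + q)) ^ 2 * ((3 / 2 : ℝ) * (p * (d - z * p)⁻¹ + q * (d - z * q)⁻¹))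
        + (d - z * (p + q)) ^ 3
            * ((3 / 2 : ℝ) * (p ^ 2 * ((d - z * p)⁻¹) ^ 2 + q ^ 2 * ((d - z * q)⁻¹) ^ 2))) z := by
    refine (((hM.fun_pow 2).const_mul (-3 * (p + q))).add ((hM.fun_pow 3).mul hH')).congr_deriv ?_
    norm_num
    ring
  exact (hE.mul hP).congr_deriv (by ring)

/-- **`G'' ≥ 0` on `[0,1]`.**  With `m = d − z(p+q)`, `a' = m·p/(d − zp) ∈ [0,p]`, `b' = m·q/(d − zq) ∈ [0,q]`:
`G'' = exp(·)·m·[3(p+q−a'−b')(2(p+q)−a'−b') + (3/4)(a'−b')²]`. [this work] -/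
theorem profile_deriv2_nonneg (d p q z : ℝ) (hp : 0 ≤ p) (hq : 0 ≤ q) (hz0 : 0 ≤ z) (hz1 : z ≤ 1)
    (hA : 0 < d - z * p) (hB : 0 < d - z * q) (he : p + q ≤ d) :
    0 ≤ Real.exp (-(3 / 2 : ℝ) * (Real.log (d - z * p) + Real.log (d - z * q)))
          * ((3 / 2 : ℝ) * (p * (d - z * p)⁻¹ + q * (d - z * q)⁻¹))
          * (-3 * (p + q) * (d - z * (p + q)) ^ 2
              + (d - z * (p + q)) ^ 3 * ((3 / 2 : ℝ) * (p * (d - z * p)⁻¹ + q * (d - z * q)⁻¹)))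
        + Real.exp (-(3 / 2 : ℝ) * (Real.log (d - z * p) + Real.log (d - z * q)))
          * (6 * (p + q) ^ 2 * (d - z * (p + q))
              - 3 * (p + q) * (d - z * (p + q)) ^ 2 * ((3 / 2 : ℝ) * (p * (d - z * p)⁻¹ + q * (d - z * q)⁻¹))
              + (d - z * (p + q)) ^ 3
                  * ((3 / 2 : ℝ) * (p ^ 2 * ((d - z * p)⁻¹) ^ 2 + q ^ 2 * ((d - z * q)⁻¹) ^ 2))) := by
  set E := Real.exp (-(3 / 2 : ℝ) * (Real.log (d - z * p) + Real.log (d - z * q))) with hEdef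
  set M := d - z * (p + q) with hMdef
  set ip := (d - z * p)⁻¹ with hipdef
  set iq := (d - z * q)⁻¹ with hiqdef
  have hE : 0 ≤ E := (Real.exp_pos _).le
  have hM0 : 0 ≤ M := by
    have : 0 ≤ (1 - z) * (p + q) := mul_nonneg (sub_nonneg.2 hz1) (add_nonneg hp hq)
    rw [hMdef]; nlinarith
  have hip : 0 < ip := inv_pos.2 hA
  have hiq : 0 < iq := inv_pos.2 hB
  have hMA : M * ip ≤ 1 := by
    have h1 : M ≤ d - z * p := by rw [hMdef]; nlinarith [mul_nonneg hz0 hq]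
    calc M * ip ≤ (d - z * p) * ip := mul_le_mul_of_nonneg_right h1 hip.le
      _ = 1 := mul_inv_cancel₀ hA.ne'
  have hMB : M * iq ≤ 1 := by
    have h1 : M ≤ d - z * q := by rw [hMdef]; nlinarith [mul_nonneg hz0 hp]
    calc M * iq ≤ (d - z * q) * iq := mul_le_mul_of_nonneg_right h1 hiq.le
      _ = 1 := mul_inv_cancel₀ hB.ne'
  have ha1 : M * p * ip ≤ p := by
    calc M * p * ip = p * (M * ip) := by ring
      _ ≤ p * 1 := mul_le_mul_of_nonneg_left hMA hp
      _ = p := mul_one p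
  have hb1 : M * q * iq ≤ q := by
    calc M * q * iq = q * (M * iq) := by ring
      _ ≤ q * 1 := mul_le_mul_of_nonneg_left hMB hq
      _ = q := mul_one q
  have key : E * ((3 / 2 : ℝ) * (p * ip + q * iq)) * (-3 * (p + q) * M ^ 2 + M ^ 3 * ((3 / 2 : ℝ) * (p * ip + q * iq)))
        + E * (6 * (p + q) ^ 2 * M - 3 * (p + q) * M ^ 2 * ((3 / 2 : ℝ) * (p * ip + q * iq))
            + M ^ 3 * ((3 / 2 : ℝ) * (p ^ 2 * ip ^ 2 + q ^ 2 * iq ^ 2)))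
      = E * (M * (3 * ((p + q) - M * p * ip - M * q * iq) * (2 * (p + q) - M * p * ip - M * q * iq)
          + 3 / 4 * (M * p * ip - M * q * iq) ^ 2)) := by
    ring
  rw [key]
  have h1 : 0 ≤ (p + q) - M * p * ip - M * q * iq := by linarith
  have h2 : 0 ≤ 2 * (p + q) - M * p * ip - M * q * iq := by linarith
  have h3 : 0 ≤ 3 * ((p + q) - M * p * ip - M * q * iq) * (2 * (p + q) - M * p * ip - M * q * iq) :=
    mul_nonneg (mul_nonneg (by norm_num) h1) h2
  have h4 : 0 ≤ 3 / 4 * (M * p * ip - M * q * iq) ^ 2 := mul_nonneg (by norm_num) (sq_nonneg _)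
  exact mul_nonneg hE (mul_nonneg hM0 (add_nonneg h3 h4))

/-- **`G` is convex on `[0,1]`** (second-derivative test). [this work] -/
theorem profile_convex (d p q : ℝ) (hp : 0 ≤ p) (hq : 0 ≤ q) (hBp : 0 < d - p) (hCq : 0 < d - q)
    (he : p + q ≤ d) :
    ConvexOn ℝ (Set.Icc (0 : ℝ) 1)
      (fun z => (d - z * (p + q)) ^ 3 * Real.exp (-(3 / 2 : ℝ) * (Real.log (d - z * p) + Real.log (d - z * q)))) := by
  have pos : ∀ z ∈ Set.Icc (0 : ℝ) 1, 0 < d - z * p ∧ 0 < d - z * q := by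
    intro z hz
    obtain ⟨hz0, hz1⟩ := hz
    constructor <;> nlinarith
  refine convexOn_of_hasDerivWithinAt2_nonneg (convex_Icc 0 1)
    (f' := fun z => Real.exp (-(3 / 2 : ℝ) * (Real.log (d - z * p) + Real.log (d - z * q))) *
        (-3 * (p + q) * (d - z * (p + q)) ^ 2
          + (d - z * (p + q)) ^ 3 * ((3 / 2 : ℝ) * (p * (d - z * p)⁻¹ + q * (d - z * q)⁻¹))))
    (f'' := fun z => Real.exp (-(3 / 2 : ℝ) * (Real.log (d - z * p) + Real.log (d - z * q)))
          * ((3 / 2 : ℝ) * (p * (d - z * p)⁻¹ + q * (d - z * q)⁻¹))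
          * (-3 * (p + q) * (d - z * (p + q)) ^ 2
              + (d - z * (p + q)) ^ 3 * ((3 / 2 : ℝ) * (p * (d - z * p)⁻¹ + q * (d - z * q)⁻¹)))
        + Real.exp (-(3 / 2 : ℝ) * (Real.log (d - z * p) + Real.log (d - z * q)))
          * (6 * (p + q) ^ 2 * (d - z * (p + q))
              - 3 * (p + q) * (d - z * (p + q)) ^ 2 * ((3 / 2 : ℝ) * (p * (d - z * p)⁻¹ + q * (d - z * q)⁻¹))
              + (d - z * (p + q)) ^ 3
                  * ((3 / 2 : ℝ) * (p ^ 2 * ((d - z * p)⁻¹) ^ 2 + q ^ 2 * ((d - z * q)⁻¹) ^ 2))))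
    ?_ ?_ ?_ ?_
  · intro z hz
    exact (profile_hasDerivAt_G d p q z (pos z hz).1.ne' (pos z hz).2.ne').continuousAt.continuousWithinAt
  · intro z hz
    have hz' := interior_subset hz
    exact (profile_hasDerivAt_G d p q z (pos z hz').1.ne' (pos z hz').2.ne').hasDerivWithinAt
  · intro z hz
    have hz' := interior_subset hz
    exact (profile_hasDerivAt_G' d p q z (pos z hz').1.ne' (pos z hz').2.ne').hasDerivWithinAt
  · intro z hz
    have hz' := interior_subset hz
    exact profile_deriv2_nonneg d p q z hp hq hz'.1 hz'.2 (pos z hz').1 (pos z hz').2 he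

/-- `(X³ · exp(−(3/2)(log A + log B)))² · (A·B)³ = X⁶` for `A, B > 0`. [folklore] -/
theorem profile_exp_sq (A B X : ℝ) (hA : 0 < A) (hB : 0 < B) :
    (X ^ 3 * Real.exp (-(3 / 2 : ℝ) * (Real.log A + Real.log B))) ^ 2 * (A * B) ^ 3 = X ^ 6 := by
  have h2 : Real.exp (-(3 / 2 : ℝ) * (Real.log A + Real.log B)) ^ 2 = ((A * B) ^ 3)⁻¹ := by
    rw [← Real.exp_nat_mul]
    have : ((2 : ℕ) : ℝ) * (-(3 / 2 : ℝ) * (Real.log A + Real.log B)) = -(Real.log ((A * B) ^ 3)) := by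
      rw [Real.log_pow, Real.log_mul hA.ne' hB.ne']
      push_cast
      ring
    rw [this, Real.exp_neg, Real.exp_log (by positivity)]
  have hAB : (A * B) ^ 3 ≠ 0 := by positivity
  calc (X ^ 3 * Real.exp (-(3 / 2 : ℝ) * (Real.log A + Real.log B))) ^ 2 * (A * B) ^ 3
      = X ^ 6 * (Real.exp (-(3 / 2 : ℝ) * (Real.log A + Real.log B)) ^ 2 * (A * B) ^ 3) := by ring
    _ = X ^ 6 * (((A * B) ^ 3)⁻¹ * (A * B) ^ 3) := by rw [h2]
    _ = X ^ 6 := by rw [inv_mul_cancel₀ hAB, mul_one]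

/-- **Chord inequality.**  If `0 ≤ p, q`, `p + q ≤ d`, `d − p > 0`, `d − q > 0`, `t ≤ 1` and
`(d − p − q)⁶ ≤ (1−t)²((d−p)(d−q))³`, then for every `z ∈ [0,1]`:
`(d − z(p+q))⁶ ≤ (1 − zt)²((d − zp)(d − zq))³` (convexity of `G` between `G(0) = 1` and `G(1) ≤ 1 − t`). [this work] -/
theorem profile_chord (d p q t z : ℝ) (hp : 0 ≤ p) (hq : 0 ≤ q) (hBp : 0 < d - p) (hCq : 0 < d - q)
    (he : p + q ≤ d) (ht : 0 ≤ 1 - t) (hz0 : 0 ≤ z) (hz1 : z ≤ 1)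
    (hyp : (d - (p + q)) ^ 6 ≤ (1 - t) ^ 2 * ((d - p) * (d - q)) ^ 3) :
    (d - z * (p + q)) ^ 6 ≤ (1 - z * t) ^ 2 * ((d - z * p) * (d - z * q)) ^ 3 := by
  have hd : 0 < d := by linarith
  have hA : 0 < d - z * p := by nlinarith
  have hB : 0 < d - z * q := by nlinarith
  have hM0 : 0 ≤ d - z * (p + q) := by
    have : 0 ≤ (1 - z) * (p + q) := mul_nonneg (sub_nonneg.2 hz1) (add_nonneg hp hq)
    nlinarith
  have hconv := profile_convex d p q hp hq hBp hCq he
  have h0mem : (0 : ℝ) ∈ Set.Icc (0 : ℝ) 1 := ⟨le_rfl, zero_le_one⟩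
  have h1mem : (1 : ℝ) ∈ Set.Icc (0 : ℝ) 1 := ⟨zero_le_one, le_rfl⟩
  have hch := hconv.2 h0mem h1mem (sub_nonneg.2 hz1) hz0 (by ring : (1 - z) + z = 1)
  simp only [smul_eq_mul, mul_zero, mul_one, zero_add, zero_mul, sub_zero, one_mul] at hch
  -- value at 0
  have hf0 : d ^ 3 * Real.exp (-(3 / 2 : ℝ) * (Real.log d + Real.log d)) = 1 := by
    have : -(3 / 2 : ℝ) * (Real.log d + Real.log d) = -(Real.log (d ^ 3)) := by
      rw [Real.log_pow]; push_cast; ring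
    rw [this, Real.exp_neg, Real.exp_log (pow_pos hd 3), mul_inv_cancel₀ (pow_pos hd 3).ne']
  -- value at 1
  have hW1 : 0 < Real.exp (-(3 / 2 : ℝ) * (Real.log (d - p) + Real.log (d - q))) := Real.exp_pos _
  have hf1sq := profile_exp_sq (d - p) (d - q) (d - (p + q)) hBp hCq
  have hf1_nonneg : 0 ≤ (d - (p + q)) ^ 3 * Real.exp (-(3 / 2 : ℝ) * (Real.log (d - p) + Real.log (d - q))) :=
    mul_nonneg (pow_nonneg (sub_nonneg.2 he) 3) hW1.le
  have hf1 : (d - (p + q)) ^ 3 * Real.exp (-(3 / 2 : ℝ) * (Real.log (d - p) + Real.log (d - q))) ≤ 1 - t := by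
    have hprod : 0 < ((d - p) * (d - q)) ^ 3 := by positivity
    have hsq : ((d - (p + q)) ^ 3 * Real.exp (-(3 / 2 : ℝ) * (Real.log (d - p) + Real.log (d - q)))) ^ 2
        ≤ (1 - t) ^ 2 := by
      have h' := hyp
      rw [← hf1sq] at h'
      exact le_of_mul_le_mul_right h' hprod
    exact (pow_le_pow_iff_left₀ hf1_nonneg ht two_ne_zero).1 hsq
  -- the chord
  have hfz : (d - z * (p + q)) ^ 3 * Real.exp (-(3 / 2 : ℝ) * (Real.log (d - z * p) + Real.log (d - z * q)))
      ≤ 1 - z * t := by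
    have hzf1 := mul_le_mul_of_nonneg_left hf1 hz0
    calc (d - z * (p + q)) ^ 3 * Real.exp (-(3 / 2 : ℝ) * (Real.log (d - z * p) + Real.log (d - z * q)))
        ≤ (1 - z) * (d ^ 3 * Real.exp (-(3 / 2 : ℝ) * (Real.log d + Real.log d)))
          + z * ((d - (p + q)) ^ 3 * Real.exp (-(3 / 2 : ℝ) * (Real.log (d - p) + Real.log (d - q)))) := hch
      _ ≤ (1 - z) * 1 + z * (1 - t) := by rw [hf0]; linarith
      _ = 1 - z * t := by ring
  have hfz0 : 0 ≤ (d - z * (p + q)) ^ 3 * Real.exp (-(3 / 2 : ℝ) * (Real.log (d - z * p) + Real.log (d - z * q))) :=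
    mul_nonneg (pow_nonneg hM0 3) (Real.exp_pos _).le
  have hsq : ((d - z * (p + q)) ^ 3 * Real.exp (-(3 / 2 : ℝ) * (Real.log (d - z * p) + Real.log (d - z * q)))) ^ 2
      ≤ (1 - z * t) ^ 2 := pow_le_pow_left₀ hfz0 hfz 2
  have hid := profile_exp_sq (d - z * p) (d - z * q) (d - z * (p + q)) hA hB
  calc (d - z * (p + q)) ^ 6
      = ((d - z * (p + q)) ^ 3 * Real.exp (-(3 / 2 : ℝ) * (Real.log (d - z * p) + Real.log (d - z * q)))) ^ 2
          * ((d - z * p) * (d - z * q)) ^ 3 := hid.symm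
    _ ≤ (1 - z * t) ^ 2 * ((d - z * p) * (d - z * q)) ^ 3 := mul_le_mul_of_nonneg_right hsq (by positivity)

/-- **APL-P is preserved by a pendant apex** (THEOREM B_P, pendant step; cell form, squared).  For nonnegative cells summing
to `1` (`u3 ≥ 0` is not needed) with `u0⁶ ≤ isoA²(isoB·isoC)³` and `z ∈ [0,1]`, the pendant image `(u0 + (1−z)e, z·uab, z·uac, ubc + (1−z)u3, z·u3)`
satisfies the same inequality: `u0'⁶ ≤ (u0' + ubc')² ((u0' + uac')(u0' + uab'))³`. [this work] -/
theorem profile_pendant (u0 uab uac ubc u3 z : ℝ) (h0 : 0 ≤ u0) (hab : 0 ≤ uab) (hac : 0 ≤ uac)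
    (hbc : 0 ≤ ubc) (hsum : u0 + uab + uac + ubc + u3 = 1) (hz0 : 0 ≤ z) (hz1 : z ≤ 1)
    (h : u0 ^ 6 ≤ (u0 + ubc) ^ 2 * ((u0 + uab) * (u0 + uac)) ^ 3) :
    (u0 + (1 - z) * (uab + uac)) ^ 6 ≤
      ((u0 + (1 - z) * (uab + uac)) + (ubc + (1 - z) * u3)) ^ 2 *
        (((u0 + (1 - z) * (uab + uac)) + z * uac) * ((u0 + (1 - z) * (uab + uac)) + z * uab)) ^ 3 := by
  have h1z : 0 ≤ 1 - z := sub_nonneg.2 hz1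
  by_cases hB0 : u0 + uac = 0
  · -- degenerate: u0 = uac = 0
    obtain ⟨hu0, huac⟩ := (add_eq_zero_iff_of_nonneg h0 hac).1 hB0
    subst hu0; subst huac
    have hisoA : 1 - z ≤ (0 + (1 - z) * (uab + 0)) + (ubc + (1 - z) * u3) := by nlinarith [mul_nonneg hz0 hbc]
    have step1 : (1 - z) ^ 2 ≤ ((0 + (1 - z) * (uab + 0)) + (ubc + (1 - z) * u3)) ^ 2 :=
      pow_le_pow_left₀ h1z hisoA 2
    have hcube : (((0 + (1 - z) * (uab + 0)) + z * 0) * ((0 + (1 - z) * (uab + 0)) + z * uab)) ^ 3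
        = (1 - z) ^ 3 * uab ^ 6 := by ring
    rw [hcube]
    calc (0 + (1 - z) * (uab + 0)) ^ 6 = (1 - z) ^ 6 * uab ^ 6 := by ring
      _ ≤ (1 - z) ^ 5 * uab ^ 6 := by
          apply mul_le_mul_of_nonneg_right _ (by positivity)
          exact pow_le_pow_of_le_one h1z (by linarith) (by norm_num : 5 ≤ 6)
      _ = (1 - z) ^ 2 * ((1 - z) ^ 3 * uab ^ 6) := by ring
      _ ≤ ((0 + (1 - z) * (uab + 0)) + (ubc + (1 - z) * u3)) ^ 2 * ((1 - z) ^ 3 * uab ^ 6) :=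
          mul_le_mul_of_nonneg_right step1 (by positivity)
  by_cases hC0 : u0 + uab = 0
  · -- degenerate: u0 = uab = 0
    obtain ⟨hu0, huab⟩ := (add_eq_zero_iff_of_nonneg h0 hab).1 hC0
    subst hu0; subst huab
    have hisoA : 1 - z ≤ (0 + (1 - z) * (0 + uac)) + (ubc + (1 - z) * u3) := by nlinarith [mul_nonneg hz0 hbc]
    have step1 : (1 - z) ^ 2 ≤ ((0 + (1 - z) * (0 + uac)) + (ubc + (1 - z) * u3)) ^ 2 :=
      pow_le_pow_left₀ h1z hisoA 2
    have hcube : (((0 + (1 - z) * (0 + uac)) + z * uac) * ((0 + (1 - z) * (0 + uac)) + z * 0)) ^ 3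
        = (1 - z) ^ 3 * uac ^ 6 := by ring
    rw [hcube]
    calc (0 + (1 - z) * (0 + uac)) ^ 6 = (1 - z) ^ 6 * uac ^ 6 := by ring
      _ ≤ (1 - z) ^ 5 * uac ^ 6 := by
          apply mul_le_mul_of_nonneg_right _ (by positivity)
          exact pow_le_pow_of_le_one h1z (by linarith) (by norm_num : 5 ≤ 6)
      _ = (1 - z) ^ 2 * ((1 - z) ^ 3 * uac ^ 6) := by ring
      _ ≤ ((0 + (1 - z) * (0 + uac)) + (ubc + (1 - z) * u3)) ^ 2 * ((1 - z) ^ 3 * uac ^ 6) :=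
          mul_le_mul_of_nonneg_right step1 (by positivity)
  -- main case
  have hBp : 0 < (u0 + uab + uac) - uab := by
    have : 0 < u0 + uac := lt_of_le_of_ne (add_nonneg h0 hac) (Ne.symm hB0)
    linarith
  have hCq : 0 < (u0 + uab + uac) - uac := by
    have : 0 < u0 + uab := lt_of_le_of_ne (add_nonneg h0 hab) (Ne.symm hC0)
    linarith
  have hyp : ((u0 + uab + uac) - (uab + uac)) ^ 6 ≤
      (1 - (uab + uac + u3)) ^ 2 * (((u0 + uab + uac) - uab) * ((u0 + uab + uac) - uac)) ^ 3 := by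
    have e2 : 1 - (uab + uac + u3) = u0 + ubc := by linear_combination -hsum
    rw [e2]
    calc ((u0 + uab + uac) - (uab + uac)) ^ 6 = u0 ^ 6 := by ring
      _ ≤ (u0 + ubc) ^ 2 * ((u0 + uab) * (u0 + uac)) ^ 3 := h
      _ = (u0 + ubc) ^ 2 * (((u0 + uab + uac) - uab) * ((u0 + uab + uac) - uac)) ^ 3 := by ring
  have key := profile_chord (u0 + uab + uac) uab uac (uab + uac + u3) z hab hac hBp hCq (by linarith)
    (by linarith) hz0 hz1 hyp
  have e5 : (u0 + (1 - z) * (uab + uac)) + (ubc + (1 - z) * u3) = 1 - z * (uab + uac + u3) := by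
    linear_combination hsum
  rw [e5]
  calc (u0 + (1 - z) * (uab + uac)) ^ 6 = ((u0 + uab + uac) - z * (uab + uac)) ^ 6 := by ring
    _ ≤ (1 - z * (uab + uac + u3)) ^ 2 * (((u0 + uab + uac) - z * uab) * ((u0 + uab + uac) - z * uac)) ^ 3 := key
    _ = (1 - z * (uab + uac + u3)) ^ 2 *
        (((u0 + (1 - z) * (uab + uac)) + z * uac) * ((u0 + (1 - z) * (uab + uac)) + z * uab)) ^ 3 := by ring

end APL

end Summit.CriticalPhenomena.PercolationContinuityZ3.Theorems
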